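import Summits.QuantumAdvantage.QuantumAdvantage.Theorems.LinnikCubicClassGroupsDegreeOnePrimesEscapeConjClassPNTRelative
import Summits.QuantumAdvantage.QuantumAdvantage.Theorems.LinnikCubicClassGroupsDegreeOnePrimesEscapeConjClassIntervalsAll
import HarnessLib

/-!
# Chebotarev bounds and a Bertrand postulate for Frobenius classes over an ARBITRARY base, Linnik range

Topic `Summits/QuantumAdvantage/QuantumAdvantage/Theorems`, cell B2b-1 (linnik-cubic), PART A (gen 16); helper
toward the crux `DegreeOnePrimesEscape` (stmt-QuantumAdvantage-11543).  HONEST FRAMING: the value of this file is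
a THEOREM (kernel-checked, GRH-free, Siegel-free, no hypothesis) — NOT summit progress.

Corollaries of `frobeniusClass_PNT_relative` (`…ConjClassPNTRelative.lean`) — `…ConjClassPNTBoundsAll.lean` /
`…ConjClassIntervalsAll.lean` (base `ℚ`, gen 13) over an arbitrary base field `F`.  Notation: `ℚ ⊆ F ⊆ N`, `N/F`
Galois, `[N:ℚ] = n`, `G = Gal(N/F)`, `σ ∈ G` ANY element, `δ = |C(σ)|/|G|`, `d = |d_N|`,
`S(x) = Σ_{𝔮 ⊂ 𝓞_F, N𝔮 = p ≤ x prime, p ∤ d_N, Frob_𝔮 ∈ C(σ)} log N𝔮`; every `x ≥ d^{L(n)}`: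

* `frobeniusClass_theta_le_rel` — Brun–Titchmarsh shape `S(x) ≤ 3 δ x`;
* `frobeniusClass_theta_ge_rel` — a universal lower bound `S(x) ≥ C(n) δ x / d^{2(1+n²)}`;
* `exists_frobenius_isConj_mem_Ioc_rel` — **a Bertrand postulate**: a prime `𝔮` of `F` with `N𝔮 = p ∈ (x, 2x]`,
  `p ∤ d_N`, `Frob_𝔮 ∈ C(σ)`; `exists_prime_isArithFrobAt_mem_Ioc_rel` — the same with `σ` itself a Frobenius at a prime above `𝔮`.
References: [LagariasMontgomeryOdlyzko1979, Theorem 1.1]; [ThornerZaman2019, Theorem 1.4]; [Stark1974].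
-/

noncomputable section

open scoped NumberField nonZeroDivisors Pointwise
open Finset Real Ideal NumberField
open Literature.NumberTheory.NumberFields Literature.NumberTheory.LFunctions
  Literature.NumberTheory.LFunctions.NumberField

namespace Summit.QuantumAdvantage.QuantumAdvantage.Theorems.DegreeOnePrimesEscape

section Group

variable {F N : Type} [Field F] [Field N] [Algebra F N] [FiniteDimensional F N]

/-- `0 < δ ≤ 1` for the density `|C(σ)|/|G|` of a conjugacy class of `Gal(N/F)`. -/
theorem classDensity_pos_le_one_rel (σ : N ≃ₐ[F] N) :
    0 < (Nat.card {τ : N ≃ₐ[F] N // IsConj σ τ} : ℝ) / Nat.card (N ≃ₐ[F] N) ∧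
      (Nat.card {τ : N ≃ₐ[F] N // IsConj σ τ} : ℝ) / Nat.card (N ≃ₐ[F] N) ≤ 1 := by
  classical
  have hG : (0 : ℝ) < Nat.card (N ≃ₐ[F] N) := by exact_mod_cast Nat.card_pos
  have h1 : (1 : ℝ) ≤ Nat.card {τ : N ≃ₐ[F] N // IsConj σ τ} := by
    haveI : Nonempty {τ : N ≃ₐ[F] N // IsConj σ τ} := ⟨⟨σ, IsConj.refl σ⟩⟩
    exact_mod_cast Nat.one_le_iff_ne_zero.mpr Nat.card_pos.ne'
  have h2 : (Nat.card {τ : N ≃ₐ[F] N // IsConj σ τ} : ℝ) ≤ Nat.card (N ≃ₐ[F] N) := by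
    exact_mod_cast Finite.card_subtype_le _
  exact ⟨div_pos (by linarith) hG, (div_le_one hG).mpr h2⟩

end Group

section Primes

variable {F : Type} [Field F] [NumberField F]

/-- If the `log N𝔮`-sum over the primes `𝔮` of `F` with `N𝔮 ≤ 2x` satisfying `P` exceeds the one over `N𝔮 ≤ x`, some
prime `𝔮` with `x < N𝔮 ≤ 2x` satisfies `P`. -/
theorem exists_primeIdeal_mem_Ioc_of_sum_lt {P : Ideal (𝓞 F) → Prop} [DecidablePred P] {x : ℝ}
    (h : ∑ q ∈ (finite_primeIdealsLE F x).toFinset with P q, Real.log (Ideal.absNorm q : ℝ) <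
      ∑ q ∈ (finite_primeIdealsLE F (2 * x)).toFinset with P q, Real.log (Ideal.absNorm q : ℝ)) :
    ∃ q : Ideal (𝓞 F), q.IsPrime ∧ x < (Ideal.absNorm q : ℝ) ∧ (Ideal.absNorm q : ℝ) ≤ 2 * x ∧ P q := by
  by_contra hne
  push Not at hne
  -- every term of the larger sum already occurs in the smaller one
  have hsub : ((finite_primeIdealsLE F (2 * x)).toFinset.filter P) ⊆ ((finite_primeIdealsLE F x).toFinset.filter P) := by
    intro q hq
    rw [Finset.mem_filter, Set.Finite.mem_toFinset] at hq ⊢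
    obtain ⟨⟨hqp, hq0, hle⟩, hP⟩ := hq
    refine ⟨⟨hqp, hq0, ?_⟩, hP⟩
    by_contra hlt
    exact hne q hqp (lt_of_not_ge hlt) hle hP
  have hle := Finset.sum_le_sum_of_subset_of_nonneg hsub
    (fun q _ _ => Real.log_natCast_nonneg (Ideal.absNorm q))
  exact absurd h (not_lt.mpr hle)

end Primes
open scoped Classical in
/-- **Brun–Titchmarsh shape for a conjugacy class in the Linnik range**: for `n > 1` there is `L > 0` with
`S(x) ≤ 3 δ x` for every Galois `N/F` with `[N:ℚ] = n`, every `σ ∈ Gal(N/F)`, every `x ≥ |d_N|^L` (`S` over the degree-one primes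
of `F`, as in `frobeniusClass_PNT_relative`).  Unconditional. [cite: LagariasMontgomeryOdlyzko1979, Theorem 1.1] -/
theorem frobeniusClass_theta_le_rel (n : ℕ) (hn : 1 < n) :
    ∃ L : ℝ, 0 < L ∧ ∀ (F N : Type) [Field F] [NumberField F] [Field N] [NumberField N] [Algebra F N]
      [IsGalois F N], Module.finrank ℚ N = n → ∀ σ : N ≃ₐ[F] N, ∀ x : ℝ, ((NumberField.discr N).natAbs : ℝ) ^ L ≤ x →
        ∑ q ∈ (finite_primeIdealsLE F x).toFinset with
            ((Ideal.absNorm q).Prime ∧ ¬ ((Ideal.absNorm q : ℤ) ∣ NumberField.discr N) ∧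
              ∃ (Q : Ideal (𝓞 N)) (_ : Q.IsMaximal) (_ : Q.LiesOver q) (φ g : N ≃ₐ[F] N),
                IsArithFrobAt (𝓞 F) φ Q ∧ Q.inertia (N ≃ₐ[F] N) = ⊥ ∧
                  g * φ * g⁻¹ = σ), Real.log (Ideal.absNorm q : ℝ) ≤
          3 * ((Nat.card {τ : N ≃ₐ[F] N // IsConj σ τ} : ℝ) / Nat.card (N ≃ₐ[F] N)) * x := by
  obtain ⟨L, c, hL, hc, hc4, h⟩ := frobeniusClass_PNT_relative n hn (ε := 1 / 7) (by norm_num) (by norm_num)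
  refine ⟨L, hL, fun F N _ _ _ _ _ _ hN σ x hx => ?_⟩
  obtain ⟨hA, hB⟩ := h F N hN σ
  obtain ⟨hδ0, hδ1⟩ := classDensity_pos_le_one_rel σ
  set δ : ℝ := (Nat.card {τ : N ≃ₐ[F] N // IsConj σ τ} : ℝ) / Nat.card (N ≃ₐ[F] N) with hδ
  have hN1 : 1 < Module.finrank ℚ N := by rw [hN]; exact hn
  set d : ℝ := ((NumberField.discr N).natAbs : ℝ) with hd
  have hd3 : (3 : ℝ) ≤ d := three_le_natAbs_discr_real N hN1
  have hx1 : 1 ≤ x := le_trans (Real.one_le_rpow (by linarith) hL.le) hx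
  have hx0 : 0 < x := by linarith
  have hδx : 0 ≤ δ * x := by positivity
  by_cases hexc : ∃ β₁ : ℝ, dedekindZeta₁ N β₁ = 0 ∧ 1 - c / (Real.log d + Real.log 4) < β₁ ∧ β₁ < 1
  · obtain ⟨β₁, hζ₁, hβ₁c, hβ₁1⟩ := hexc
    have hβ34 : 3 / 4 ≤ β₁ := three_quarters_le_of_window hc hc4 hd3 hβ₁c
    have hβ0 : 0 < β₁ := by linarith
    have hy0 : 0 ≤ x ^ β₁ / β₁ := div_nonneg (Real.rpow_nonneg hx0.le _) hβ0.le
    have hyx : x ^ β₁ / β₁ ≤ 4 / 3 * x := by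
      have h1 : x ^ β₁ ≤ x := by
        have := Real.rpow_le_rpow_of_exponent_le hx1 hβ₁1.le; rwa [Real.rpow_one] at this
      rw [div_le_iff₀ hβ0]; nlinarith
    obtain ⟨hB1, hB2⟩ := hB β₁ hζ₁ hβ₁c hβ₁1
    by_cases hζσ : dedekindZeta₁ (IntermediateField.fixedField (Subgroup.zpowers σ)) β₁ = 0
    · obtain ⟨hxy, hb⟩ := hB1 hζσ x hx
      have := (abs_le.mp hb).2
      nlinarith
    · have hb := hB2 hζσ x hx
      have := (abs_le.mp hb).2
      nlinarith
  · have hb := hA hexc x hx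
    have := (abs_le.mp hb).2
    nlinarith

open scoped Classical in
/-- **A universal lower bound for a conjugacy class in the Linnik range**: for `n > 1` there are `L, C > 0` with
`S(x) ≥ C δ x / |d_N|^{2(1+n²)}` for every Galois `N/F` with `[N:ℚ] = n`, every `σ ∈ Gal(N/F)`, every `x ≥ |d_N|^L` (the loss
`|d_N|^{−2(1+n²)}` only occurs when `σ` lies in the kernel of an exceptional quadratic character, by Stark's
effective bound for `1 − β₁`).  Unconditional. [cite: LagariasMontgomeryOdlyzko1979, Theorem 1.1]
[cite: Stark1974, Theorem 1'] -/
theorem frobeniusClass_theta_ge_rel (n : ℕ) (hn : 1 < n) :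
    ∃ L C : ℝ, 0 < L ∧ 0 < C ∧ ∀ (F N : Type) [Field F] [NumberField F] [Field N] [NumberField N] [Algebra F N]
      [IsGalois F N], Module.finrank ℚ N = n → ∀ σ : N ≃ₐ[F] N, ∀ x : ℝ, ((NumberField.discr N).natAbs : ℝ) ^ L ≤ x →
        C * (((Nat.card {τ : N ≃ₐ[F] N // IsConj σ τ} : ℝ) / Nat.card (N ≃ₐ[F] N)) * x) /
            ((NumberField.discr N).natAbs : ℝ) ^ (2 * ((1 : ℝ) + n * n)) ≤
          ∑ q ∈ (finite_primeIdealsLE F x).toFinset with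
            ((Ideal.absNorm q).Prime ∧ ¬ ((Ideal.absNorm q : ℤ) ∣ NumberField.discr N) ∧
              ∃ (Q : Ideal (𝓞 N)) (_ : Q.IsMaximal) (_ : Q.LiesOver q) (φ g : N ≃ₐ[F] N),
                IsArithFrobAt (𝓞 F) φ Q ∧ Q.inertia (N ≃ₐ[F] N) = ⊥ ∧
                  g * φ * g⁻¹ = σ), Real.log (Ideal.absNorm q : ℝ) := by
  obtain ⟨L₁, c, hL₁, hc, hc4, h⟩ := frobeniusClass_PNT_relative n hn (ε := 1 / 2) (by norm_num) (by norm_num)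
  obtain ⟨c₁, hc₁, hc₁1, hMT⟩ := exceptional_mainTerm_ge' n hn
  set L : ℝ := max L₁ 16 with hL
  refine ⟨L, c₁ / 8, lt_of_lt_of_le hL₁ (le_max_left _ _), by positivity, fun F N _ _ _ _ _ _ hN σ x hx => ?_⟩
  obtain ⟨hA, hB⟩ := h F N hN σ
  obtain ⟨hδ0, hδ1⟩ := classDensity_pos_le_one_rel σ
  set δ : ℝ := (Nat.card {τ : N ≃ₐ[F] N // IsConj σ τ} : ℝ) / Nat.card (N ≃ₐ[F] N) with hδ
  have hN1 : 1 < Module.finrank ℚ N := by rw [hN]; exact hn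
  set d : ℝ := ((NumberField.discr N).natAbs : ℝ) with hd
  have hd3 : (3 : ℝ) ≤ d := three_le_natAbs_discr_real N hN1
  have hd1 : (1 : ℝ) ≤ d := by linarith
  have hx₁ : d ^ L₁ ≤ x := rpow_le_of_rpow_le hd1 (le_max_left _ _) hx
  have h16 : d ^ (16 : ℝ) ≤ x := rpow_le_of_rpow_le hd1 (le_max_right _ _) hx
  have hx16 : 16 ≤ Real.log x := by
    have hlog3 : 1 ≤ Real.log d := by
      rw [Real.le_log_iff_exp_le (by linarith)]
      have := Real.exp_one_lt_d9; linarith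
    have h1 := Real.log_le_log (Real.rpow_pos_of_pos (by linarith) _) h16
    rw [Real.log_rpow (by linarith)] at h1
    nlinarith
  have hx1 : 1 < x := by
    have := Real.add_one_le_exp (16 : ℝ)
    have h2 : Real.exp 16 ≤ x := by
      have := Real.exp_le_exp.mpr hx16
      rwa [Real.exp_log (by linarith [Real.rpow_pos_of_pos (show (0:ℝ) < d by linarith) L])] at this
    linarith
  have hx0 : 0 < x := by linarith
  set D : ℝ := d ^ (2 * ((1 : ℝ) + n * n)) with hD
  have hD1 : 1 ≤ D := Real.one_le_rpow hd1 (by positivity)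
  have hD0 : 0 < D := by linarith
  have hδx : 0 ≤ δ * x := by positivity
  -- the easy cases give `S ≥ δx/2 ≥ (c₁/8) δ x / D`
  have heasy : δ * x / 2 ≥ c₁ / 8 * (δ * x) / D := by
    rw [ge_iff_le, div_le_iff₀ hD0]
    have : c₁ / 8 * (δ * x) ≤ δ * x / 2 * 1 := by nlinarith
    nlinarith [mul_le_mul_of_nonneg_left hD1 (by positivity : 0 ≤ δ * x / 2)]
  by_cases hexc : ∃ β₁ : ℝ, dedekindZeta₁ N β₁ = 0 ∧ 1 - c / (Real.log d + Real.log 4) < β₁ ∧ β₁ < 1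
  · obtain ⟨β₁, hζ₁, hβ₁c, hβ₁1⟩ := hexc
    have hβ34 : 3 / 4 ≤ β₁ := three_quarters_le_of_window hc hc4 hd3 hβ₁c
    have hβ0 : 0 < β₁ := by linarith
    have hy0 : 0 ≤ x ^ β₁ / β₁ := div_nonneg (Real.rpow_nonneg hx0.le _) hβ0.le
    obtain ⟨hB1, hB2⟩ := hB β₁ hζ₁ hβ₁c hβ₁1
    by_cases hζσ : dedekindZeta₁ (IntermediateField.fixedField (Subgroup.zpowers σ)) β₁ = 0
    · obtain ⟨hxy, hb⟩ := hB1 hζσ x hx₁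
      have h1 := (abs_le.mp hb).1
      have hW : x * c₁ / (4 * D) ≤ x - x ^ β₁ / β₁ := hMT N hN β₁ hζ₁ hβ34 hβ₁1 x hx1 hx16
      -- `S ≥ δ (x − y)/2 ≥ δ x c₁/(8 D)`
      have h2 : c₁ / 8 * (δ * x) / D = δ * (x * c₁ / (4 * D)) / 2 := by field_simp; ring
      rw [h2]
      nlinarith [mul_le_mul_of_nonneg_left hW hδ0.le]
    · have hb := hB2 hζσ x hx₁
      have h1 := (abs_le.mp hb).1
      nlinarith
  · have hb := hA hexc x hx₁
    have h1 := (abs_le.mp hb).1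
    nlinarith

set_option maxHeartbeats 1600000 in
open scoped Classical in
/-- **A Bertrand postulate for Frobenius conjugacy classes in the Linnik range, arbitrary base**: for `n > 1` there
is `L > 0` such that for every Galois `N/F` with `[N:ℚ] = n`, every `σ ∈ Gal(N/F)` and every `x ≥ |d_N|^L` some
prime `𝔮` of `F` with `N𝔮 = p ∈ (x, 2x]` a rational prime, `p ∤ d_N`, has a Frobenius (over `𝓞_F`, at a prime of `N`
with trivial inertia) conjugate to `σ`.  Unconditional. [cite: LagariasMontgomeryOdlyzko1979, Theorem 1.1] -/
theorem exists_frobenius_isConj_mem_Ioc_rel (n : ℕ) (hn : 1 < n) :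
    ∃ L : ℝ, 0 < L ∧ ∀ (F N : Type) [Field F] [NumberField F] [Field N] [NumberField N] [Algebra F N]
      [IsGalois F N], Module.finrank ℚ N = n → ∀ σ : N ≃ₐ[F] N, ∀ x : ℝ, ((NumberField.discr N).natAbs : ℝ) ^ L ≤ x →
        ∃ q : Ideal (𝓞 F), q.IsPrime ∧ x < (Ideal.absNorm q : ℝ) ∧ (Ideal.absNorm q : ℝ) ≤ 2 * x ∧
          (Ideal.absNorm q).Prime ∧ ¬ ((Ideal.absNorm q : ℤ) ∣ NumberField.discr N) ∧
          ∃ (Q : Ideal (𝓞 N)) (_ : Q.IsMaximal) (_ : Q.LiesOver q) (φ g : N ≃ₐ[F] N),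
            IsArithFrobAt (𝓞 F) φ Q ∧ Q.inertia (N ≃ₐ[F] N) = ⊥ ∧
              g * φ * g⁻¹ = σ := by
  obtain ⟨L, c, hL, hc, hc4, h⟩ := frobeniusClass_PNT_relative n hn (ε := 1 / 7) (by norm_num) (by norm_num)
  refine ⟨L, hL, fun F N _ _ _ _ _ _ hN σ x hx => ?_⟩
  obtain ⟨hA, hB⟩ := h F N hN σ
  obtain ⟨hδ0, hδ1⟩ := classDensity_pos_le_one_rel σ
  set δ : ℝ := (Nat.card {τ : N ≃ₐ[F] N // IsConj σ τ} : ℝ) / Nat.card (N ≃ₐ[F] N) with hδ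
  have hN1 : 1 < Module.finrank ℚ N := by rw [hN]; exact hn
  set d : ℝ := ((NumberField.discr N).natAbs : ℝ) with hd
  have hd3 : (3 : ℝ) ≤ d := three_le_natAbs_discr_real N hN1
  have hx1 : 1 ≤ x := le_trans (Real.one_le_rpow (by linarith) hL.le) hx
  have hx0 : 0 < x := by linarith
  have h2x : d ^ L ≤ 2 * x := by linarith
  have hδx : 0 < δ * x := by positivity
  have hgoal : ∑ q ∈ (finite_primeIdealsLE F x).toFinset with
        ((Ideal.absNorm q).Prime ∧ ¬ ((Ideal.absNorm q : ℤ) ∣ NumberField.discr N) ∧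
          ∃ (Q : Ideal (𝓞 N)) (_ : Q.IsMaximal) (_ : Q.LiesOver q) (φ g : N ≃ₐ[F] N),
            IsArithFrobAt (𝓞 F) φ Q ∧ Q.inertia (N ≃ₐ[F] N) = ⊥ ∧
              g * φ * g⁻¹ = σ), Real.log (Ideal.absNorm q : ℝ) <
      ∑ q ∈ (finite_primeIdealsLE F (2 * x)).toFinset with
        ((Ideal.absNorm q).Prime ∧ ¬ ((Ideal.absNorm q : ℤ) ∣ NumberField.discr N) ∧
          ∃ (Q : Ideal (𝓞 N)) (_ : Q.IsMaximal) (_ : Q.LiesOver q) (φ g : N ≃ₐ[F] N),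
            IsArithFrobAt (𝓞 F) φ Q ∧ Q.inertia (N ≃ₐ[F] N) = ⊥ ∧
              g * φ * g⁻¹ = σ), Real.log (Ideal.absNorm q : ℝ) := by
    -- `S(x) < S(2x)` in each case of the prime number theorem
    by_cases hexc : ∃ β₁ : ℝ, dedekindZeta₁ N β₁ = 0 ∧ 1 - c / (Real.log d + Real.log 4) < β₁ ∧ β₁ < 1
    · obtain ⟨β₁, hζ₁, hβ₁c, hβ₁1⟩ := hexc
      have hβ34 : 3 / 4 ≤ β₁ := three_quarters_le_of_window hc hc4 hd3 hβ₁c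
      have hβ0 : 0 < β₁ := by linarith
      have hy0 : 0 ≤ x ^ β₁ / β₁ := div_nonneg (Real.rpow_nonneg hx0.le _) hβ0.le
      have h2β : (2 * x) ^ β₁ = (2 : ℝ) ^ β₁ * x ^ β₁ := Real.mul_rpow (by norm_num) hx0.le
      have h2β1 : (1 : ℝ) ≤ (2 : ℝ) ^ β₁ := Real.one_le_rpow (by norm_num) hβ0.le
      have h2β2 : (2 : ℝ) ^ β₁ ≤ 2 := by
        have := Real.rpow_le_rpow_of_exponent_le (show (1:ℝ) ≤ 2 by norm_num) hβ₁1.le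
        rwa [Real.rpow_one] at this
      obtain ⟨hB1, hB2⟩ := hB β₁ hζ₁ hβ₁c hβ₁1
      by_cases hζσ : dedekindZeta₁ (IntermediateField.fixedField (Subgroup.zpowers σ)) β₁ = 0
      · -- main term `F(t) = t − t^β/β`, `F(2x) ≥ 2 F(x)`
        obtain ⟨hxy, hbx⟩ := hB1 hζσ x hx
        obtain ⟨-, hb2x⟩ := hB1 hζσ (2 * x) h2x
        have hux := (abs_le.mp hbx).2
        have hl2x := (abs_le.mp hb2x).1
        rw [h2β] at hl2x
        have hF : 2 * (x - x ^ β₁ / β₁) ≤ 2 * x - (2 : ℝ) ^ β₁ * x ^ β₁ / β₁ := by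
          have : (2 : ℝ) ^ β₁ * x ^ β₁ / β₁ ≤ 2 * (x ^ β₁ / β₁) := by
            rw [mul_div_assoc]; exact mul_le_mul_of_nonneg_right h2β2 hy0
          linarith
        have hδF : δ * (2 * (x - x ^ β₁ / β₁)) ≤ δ * (2 * x - (2 : ℝ) ^ β₁ * x ^ β₁ / β₁) :=
          mul_le_mul_of_nonneg_left hF hδ0.le
        have hδf : 0 < δ * (x - x ^ β₁ / β₁) := mul_pos hδ0 hxy
        linarith
      · -- main term `F(t) = t + t^β/β`
        have hbx := hB2 hζσ x hx
        have hb2x := hB2 hζσ (2 * x) h2x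
        have hux := (abs_le.mp hbx).2
        have hl2x := (abs_le.mp hb2x).1
        rw [h2β] at hl2x
        have hF : x ^ β₁ / β₁ ≤ (2 : ℝ) ^ β₁ * x ^ β₁ / β₁ := by
          rw [mul_div_assoc]; exact le_mul_of_one_le_left hy0 h2β1
        have hyx : x ^ β₁ / β₁ ≤ 4 / 3 * x := by
          have h1 : x ^ β₁ ≤ x := by
            have := Real.rpow_le_rpow_of_exponent_le hx1 hβ₁1.le; rwa [Real.rpow_one] at this
          rw [div_le_iff₀ hβ0]; nlinarith
        have hδy : δ * (x ^ β₁ / β₁) ≤ δ * (4 / 3 * x) := mul_le_mul_of_nonneg_left hyx hδ0.le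
        have hδz : δ * (x ^ β₁ / β₁) ≤ δ * ((2 : ℝ) ^ β₁ * x ^ β₁ / β₁) :=
          mul_le_mul_of_nonneg_left hF hδ0.le
        linarith
    · have hbx := hA hexc x hx
      have hb2x := hA hexc (2 * x) h2x
      have hux := (abs_le.mp hbx).2
      have hl2x := (abs_le.mp hb2x).1
      linarith
  obtain ⟨q, hq, hxq, hq2, hP⟩ := exists_primeIdeal_mem_Ioc_of_sum_lt
    (P := fun q : Ideal (𝓞 F) => (Ideal.absNorm q).Prime ∧ ¬ ((Ideal.absNorm q : ℤ) ∣ NumberField.discr N) ∧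
      ∃ (Q : Ideal (𝓞 N)) (_ : Q.IsMaximal) (_ : Q.LiesOver q) (φ g : N ≃ₐ[F] N),
        IsArithFrobAt (𝓞 F) φ Q ∧ Q.inertia (N ≃ₐ[F] N) = ⊥ ∧ g * φ * g⁻¹ = σ) hgoal
  exact ⟨q, hq, hxq, hq2, hP.1, hP.2.1, hP.2.2⟩


open scoped Classical in
/-- **Bertrand for a prescribed Frobenius ELEMENT over an arbitrary base**: for `n > 1` there is `L > 0` such that for
every Galois `N/F` with `[N:ℚ] = n`, every `σ ∈ Gal(N/F)` and every `x ≥ |d_N|^L` there is a prime `𝔮` of `F` with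
`N𝔮 = p ∈ (x, 2x]` prime, `p ∤ d_N`, and a prime `𝔔 ∣ 𝔮` of `N` at which `σ` itself is an arithmetic Frobenius over
`𝓞_F`. [cite: LagariasMontgomeryOdlyzko1979, Theorem 1.1] -/
theorem exists_prime_isArithFrobAt_mem_Ioc_rel (n : ℕ) (hn : 1 < n) :
    ∃ L : ℝ, 0 < L ∧ ∀ (F N : Type) [Field F] [NumberField F] [Field N] [NumberField N] [Algebra F N]
      [IsGalois F N], Module.finrank ℚ N = n → ∀ σ : N ≃ₐ[F] N, ∀ x : ℝ, ((NumberField.discr N).natAbs : ℝ) ^ L ≤ x →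
        ∃ q : Ideal (𝓞 F), q.IsPrime ∧ x < (Ideal.absNorm q : ℝ) ∧ (Ideal.absNorm q : ℝ) ≤ 2 * x ∧
          (Ideal.absNorm q).Prime ∧ ¬ ((Ideal.absNorm q : ℤ) ∣ NumberField.discr N) ∧
          ∃ (Q : Ideal (𝓞 N)) (_ : Q.IsMaximal) (_ : Q.LiesOver q), IsArithFrobAt (𝓞 F) σ Q := by
  obtain ⟨L, hL, h⟩ := exists_frobenius_isConj_mem_Ioc_rel n hn
  refine ⟨L, hL, fun F N _ _ _ _ _ _ hN σ x hx => ?_⟩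
  obtain ⟨q, hq, hxq, hq2, hprime, hnd, Q, hQmax, hQover, φ, g, hφ, -, hg⟩ := h F N hN σ x hx
  haveI := hQmax
  haveI := hQover
  haveI : IsGaloisGroup (N ≃ₐ[F] N) (𝓞 F) (𝓞 N) := IsGaloisGroup.of_isFractionRing _ _ _ F N
  have hq0 : q ≠ ⊥ := by
    intro h0; rw [h0, Ideal.absNorm_bot] at hprime; exact Nat.not_prime_zero hprime
  haveI : q.IsMaximal := hq.isMaximal hq0
  refine ⟨q, hq, hxq, hq2, hprime, hnd, g • Q, ?_, inferInstance, ?_⟩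
  · exact Ideal.IsPrime.isMaximal inferInstance (Ideal.ne_bot_of_liesOver_of_ne_bot hq0 _)
  · rw [← hg]; exact hφ.conj g

end Summit.QuantumAdvantage.QuantumAdvantage.Theorems.DegreeOnePrimesEscape

end
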